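import Summits.CriticalPhenomena.Ising3DConformalLimit.Theses.BallSpecification
import Summits.CriticalPhenomena.Ising3DConformalLimit.Theorems.BallSpecificationBallSpecifiedInversionUpgradeLowOrderClass
import HarnessLib

/-!
# The `n ≤ 2` core of stub `stub_stationaryShellTiltRigidity` (S2a₅, skeleton r5 of line `birth`) for crux
# `BallSpecifiedInversionUpgrade` (stmt-CriticalPhenomena-11248)

Route `route-CriticalPhenomena-BallSpecification`, sub-problem `Ising3DConformalLimit`.  Target tree file:
`Summits/CriticalPhenomena/Ising3DConformalLimit/Theorems/BallSpecificationBallSpecifiedInversionUpgradeStationaryShellTiltRigidity.lean`,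
landed with `--supports stmt-CriticalPhenomena-11248`.

## Content

The registered stub S2a₅ `stub_stationaryShellTiltRigidity` is the `μ`-only part of punctured uniqueness:
under the crux antecedent `H` (a ball-specified scaling limit `(ρ, Δ, S, L, μ, γ)` of critical Ising₃), every
normalised family of shell densities `g s ≥ 0` (`0 < s < 1`; Borel, measurable with respect to
`extEvents (R_s)ᶜ`, `R_s = {s < ‖x‖ < s⁻¹}`) whose tilts `ν_s := g s · μ` are consistent on `extEvents R_{s'}`,
(DI) dilation stationary with weight `Δ`, (RI) rotation invariant and in the exact low-order class of `μ`
(`ω f ∈ L²(ν_s)`, `∫ ω f dν_s = 0`, `∫ (ω f)² dν_s = ∫ (ω f)² dμ` for `f` compactly supported in `R_s`) has ALL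
the punctured moments of `μ`: `moment (ν_s) n f = moment μ n f`.  For `n ≥ 3` this is open (it says that the
critical Ising₃ field has no dilation-stationary, isotropic, exact-class boundary-state family at `{0, ∞}`; no
clause of `H` controls non-linear functionals of the field in the hole).  This file lands the PROVABLE CORE,
the orders `n ≤ 2`, as the registered sub-goal `stationaryShellTilt_moment_le_two` — literally the stub's
statement with the extra hypothesis `n ≤ 2` after the binder `(n : ℕ) (f : Fin n → 𝓢(ℝ³, ℝ))`:

* `n = 0`: both laws are probability measures (`∫⁻ g s dμ = 1`; `IsGibbsFor γ μ univ`), both moments are `1`;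
* `n = 1`: both first moments vanish — `ν_s`'s by the class hypothesis, `μ`'s by `stub_lowOrderClass` (b)
  (`S 1 ≡ 0` for normalised limits of the critical correlators);
* `n = 2`: polarisation `ω(f₀) ω(f₁) = ¼ ((ω(f₀ + f₁))² − (ω(f₀ − f₁))²)` (`ω` is linear), the exact second
  moments of the class hypothesis at `f₀ ± f₁` (still compactly supported in `R_s`), and square integrability
  on both sides (`MemLp 2` from the class hypothesis for `ν_s`, from `stub_lowOrderClass` (a) for `μ`) to split
  the integrals.

Only the class hypothesis, the normalisation `∫⁻ g s dμ = 1` and `H` (through `stub_lowOrderClass` and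
`IsGibbsFor γ μ univ`) are used; consistency, (DI), (RI) and the `extEvents (R_s)ᶜ`-measurability of `g s` are
carried verbatim from the registered statement.  Nothing is claimed for `n ≥ 3`.  The argument is isolated in
the abstract lemma `moment_eq_of_exactClass_of_le_two` (two probability laws, `μ` square integrable and centred
on the test functions compactly supported in a region `R`, `ν` in the exact low-order class of `μ` on `R` ⇒
moments of orders `≤ 2` on such test functions agree), reusable for every competitor family of the
punctured-uniqueness clause (PU'₅), not only for shell tilts.

References: J. Glimm, A. Jaffe, *Quantum Physics* (1987) §6.1 (moments of laws on `𝒮'`); the polarisation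
identity is folklore.  Theorem-only file (no definitions).
-/

noncomputable section

namespace Summit.CriticalPhenomena.Ising3DConformalLimit.BallSpecificationBallSpecifiedInversionUpgrade

open MeasureTheory
open Literature.Probability.LatticeModels Literature.MathematicalPhysics.QuantumLattice

/-! ### Elementary helpers -/

/-- **Polarisation of a mixed second moment.**  For real `X, Y ∈ L²(ν)`:
`∫ X Y dν = ¼ (∫ (X + Y)² dν − ∫ (X − Y)² dν)` (the pointwise identity `XY = ¼((X+Y)² − (X−Y)²)`
integrated; square integrability is needed only to split the integral of the difference). [folklore] -/
theorem integral_mul_eq_polarisation {Ω : Type*} [MeasurableSpace Ω] (ν : Measure Ω)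
    {X Y : Ω → ℝ} (hX : MemLp X 2 ν) (hY : MemLp Y 2 ν) :
    ∫ ω, X ω * Y ω ∂ν = 4⁻¹ * ((∫ ω, (X ω + Y ω) ^ 2 ∂ν) - ∫ ω, (X ω - Y ω) ^ 2 ∂ν) := by
  have hp : Integrable (fun ω => (X ω + Y ω) ^ 2) ν := (hX.add hY).integrable_sq
  have hm : Integrable (fun ω => (X ω - Y ω) ^ 2) ν := (hX.sub hY).integrable_sq
  rw [← integral_sub hp hm, ← integral_const_mul]
  refine integral_congr_ae (Filter.Eventually.of_forall fun ω => ?_)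
  ring

/-- **Mixed second moments are determined by the diagonal ones.**  If `ω ↦ ω f₀` and `ω ↦ ω f₁` are in `L²`
of two laws `ν`, `μ` on `𝓢'(ℝ³)` whose second moments agree at `f₀ + f₁` and at `f₀ - f₁`, then
`∫ ω f₀ · ω f₁ dν = ∫ ω f₀ · ω f₁ dμ` (polarisation and linearity of `ω`). [folklore] -/
theorem integral_eval_mul_eq_of_sq_eq {ν μ : Measure (FieldConfig (EuclideanSpace ℝ (Fin 3)))}
    {f₀ f₁ : SchwartzMap (EuclideanSpace ℝ (Fin 3)) ℝ}
    (hν₀ : MemLp (fun ω : FieldConfig (EuclideanSpace ℝ (Fin 3)) => ω f₀) 2 ν)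
    (hν₁ : MemLp (fun ω : FieldConfig (EuclideanSpace ℝ (Fin 3)) => ω f₁) 2 ν)
    (hμ₀ : MemLp (fun ω : FieldConfig (EuclideanSpace ℝ (Fin 3)) => ω f₀) 2 μ)
    (hμ₁ : MemLp (fun ω : FieldConfig (EuclideanSpace ℝ (Fin 3)) => ω f₁) 2 μ)
    (hadd : ∫ ω : FieldConfig (EuclideanSpace ℝ (Fin 3)), (ω (f₀ + f₁)) ^ 2 ∂ν =
      ∫ ω : FieldConfig (EuclideanSpace ℝ (Fin 3)), (ω (f₀ + f₁)) ^ 2 ∂μ)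
    (hsub : ∫ ω : FieldConfig (EuclideanSpace ℝ (Fin 3)), (ω (f₀ - f₁)) ^ 2 ∂ν =
      ∫ ω : FieldConfig (EuclideanSpace ℝ (Fin 3)), (ω (f₀ - f₁)) ^ 2 ∂μ) :
    ∫ ω : FieldConfig (EuclideanSpace ℝ (Fin 3)), ω f₀ * ω f₁ ∂ν =
      ∫ ω : FieldConfig (EuclideanSpace ℝ (Fin 3)), ω f₀ * ω f₁ ∂μ := by
  simp only [map_add, map_sub] at hadd hsub
  rw [integral_mul_eq_polarisation ν hν₀ hν₁, integral_mul_eq_polarisation μ hμ₀ hμ₁, hadd, hsub]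

/-- The sum of two test functions compactly supported in a set `R` is compactly supported in `R`. [folklore] -/
theorem hasCompactSupport_add_of {R : Set (EuclideanSpace ℝ (Fin 3))}
    {f₀ f₁ : SchwartzMap (EuclideanSpace ℝ (Fin 3)) ℝ}
    (h₀ : HasCompactSupport (f₀ : EuclideanSpace ℝ (Fin 3) → ℝ) ∧
      tsupport (f₀ : EuclideanSpace ℝ (Fin 3) → ℝ) ⊆ R)
    (h₁ : HasCompactSupport (f₁ : EuclideanSpace ℝ (Fin 3) → ℝ) ∧
      tsupport (f₁ : EuclideanSpace ℝ (Fin 3) → ℝ) ⊆ R) :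
    HasCompactSupport ((f₀ + f₁ : SchwartzMap (EuclideanSpace ℝ (Fin 3)) ℝ) : EuclideanSpace ℝ (Fin 3) → ℝ) ∧
      tsupport ((f₀ + f₁ : SchwartzMap (EuclideanSpace ℝ (Fin 3)) ℝ) : EuclideanSpace ℝ (Fin 3) → ℝ) ⊆ R := by
  rw [FunLike.coe_add]
  exact ⟨h₀.1.add h₁.1, (tsupport_add _ _).trans (Set.union_subset h₀.2 h₁.2)⟩

/-- The difference of two test functions compactly supported in a set `R` is compactly supported in `R`. [folklore] -/
theorem hasCompactSupport_sub_of {R : Set (EuclideanSpace ℝ (Fin 3))}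
    {f₀ f₁ : SchwartzMap (EuclideanSpace ℝ (Fin 3)) ℝ}
    (h₀ : HasCompactSupport (f₀ : EuclideanSpace ℝ (Fin 3) → ℝ) ∧
      tsupport (f₀ : EuclideanSpace ℝ (Fin 3) → ℝ) ⊆ R)
    (h₁ : HasCompactSupport (f₁ : EuclideanSpace ℝ (Fin 3) → ℝ) ∧
      tsupport (f₁ : EuclideanSpace ℝ (Fin 3) → ℝ) ⊆ R) :
    HasCompactSupport ((f₀ - f₁ : SchwartzMap (EuclideanSpace ℝ (Fin 3)) ℝ) : EuclideanSpace ℝ (Fin 3) → ℝ) ∧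
      tsupport ((f₀ - f₁ : SchwartzMap (EuclideanSpace ℝ (Fin 3)) ℝ) : EuclideanSpace ℝ (Fin 3) → ℝ) ⊆ R := by
  rw [FunLike.coe_sub]
  exact ⟨h₀.1.sub h₁.1, (tsupport_sub _ _).trans (Set.union_subset h₀.2 h₁.2)⟩

/-- A law tilted by a normalised `ℝ≥0∞`-density is a probability measure. [folklore] -/
theorem isProbabilityMeasure_withDensity_of_lintegral_eq_one
    {μ : Measure (FieldConfig (EuclideanSpace ℝ (Fin 3)))}
    {h : FieldConfig (EuclideanSpace ℝ (Fin 3)) → ENNReal} (hone : ∫⁻ ω, h ω ∂μ = 1) :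
    IsProbabilityMeasure (μ.withDensity h) :=
  ⟨by rw [withDensity_apply _ MeasurableSet.univ, Measure.restrict_univ, hone]⟩

/-! ### Moments of order `≤ 2` in the exact low-order class (abstract form) -/

/-- **Orders `≤ 2` of punctured uniqueness are free.**  Let `ν`, `μ` be probability laws on `𝓢'(ℝ³)` and `R` a
region such that, for every test function `f` compactly supported in `R`, `ω f ∈ L²(μ)` with `∫ ω f dμ = 0`, and
`ν` is in the exact low-order class of `μ` on `R` (`ω f ∈ L²(ν)`, `∫ ω f dν = 0`, `∫ (ω f)² dν = ∫ (ω f)² dμ`).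
Then `moment ν n f = moment μ n f` for `n ≤ 2` and `f i` compactly supported in `R`: order `0` is normalisation,
order `1` is centredness, order `2` is polarisation of the exact second moments at `f 0 ± f 1`.  (Reusable for
any competitor family of the punctured-uniqueness clause, not only shell tilts.) [cite: GlimmJaffe1987, §6.1] -/
theorem moment_eq_of_exactClass_of_le_two {R : Set (EuclideanSpace ℝ (Fin 3))}
    {ν μ : Measure (FieldConfig (EuclideanSpace ℝ (Fin 3)))} [IsProbabilityMeasure ν] [IsProbabilityMeasure μ]
    (hμ : ∀ f : SchwartzMap (EuclideanSpace ℝ (Fin 3)) ℝ, HasCompactSupport (f : EuclideanSpace ℝ (Fin 3) → ℝ) →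
      tsupport (f : EuclideanSpace ℝ (Fin 3) → ℝ) ⊆ R →
        MemLp (fun ω : FieldConfig (EuclideanSpace ℝ (Fin 3)) => ω f) 2 μ ∧
          ∫ ω : FieldConfig (EuclideanSpace ℝ (Fin 3)), ω f ∂μ = 0)
    (hν : ∀ f : SchwartzMap (EuclideanSpace ℝ (Fin 3)) ℝ, HasCompactSupport (f : EuclideanSpace ℝ (Fin 3) → ℝ) →
      tsupport (f : EuclideanSpace ℝ (Fin 3) → ℝ) ⊆ R →
        MemLp (fun ω : FieldConfig (EuclideanSpace ℝ (Fin 3)) => ω f) 2 ν ∧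
          ∫ ω : FieldConfig (EuclideanSpace ℝ (Fin 3)), ω f ∂ν = 0 ∧
            ∫ ω : FieldConfig (EuclideanSpace ℝ (Fin 3)), (ω f) ^ 2 ∂ν =
              ∫ ω : FieldConfig (EuclideanSpace ℝ (Fin 3)), (ω f) ^ 2 ∂μ)
    {n : ℕ} (hn : n ≤ 2) (f : Fin n → SchwartzMap (EuclideanSpace ℝ (Fin 3)) ℝ)
    (hf : ∀ i, HasCompactSupport (f i : EuclideanSpace ℝ (Fin 3) → ℝ) ∧
      tsupport (f i : EuclideanSpace ℝ (Fin 3) → ℝ) ⊆ R) :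
    moment ν n f = moment μ n f := by
  obtain rfl | rfl | rfl : n = 0 ∨ n = 1 ∨ n = 2 := by omega
  · -- order 0: both laws are probability measures
    simp [moment]
  · -- order 1: both laws are centred on test functions compactly supported in `R`
    simp only [moment, Fin.prod_univ_one]
    rw [(hν (f 0) (hf 0).1 (hf 0).2).2.1, (hμ (f 0) (hf 0).1 (hf 0).2).2]
  · -- order 2: polarisation of the exact second moments at `f 0 ± f 1`
    simp only [moment, Fin.prod_univ_two]
    have h0 := hν (f 0) (hf 0).1 (hf 0).2
    have h1 := hν (f 1) (hf 1).1 (hf 1).2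
    have hadd := hν (f 0 + f 1) (hasCompactSupport_add_of (hf 0) (hf 1)).1
      (hasCompactSupport_add_of (hf 0) (hf 1)).2
    have hsub := hν (f 0 - f 1) (hasCompactSupport_sub_of (hf 0) (hf 1)).1
      (hasCompactSupport_sub_of (hf 0) (hf 1)).2
    exact integral_eval_mul_eq_of_sq_eq h0.1 h1.1 (hμ _ (hf 0).1 (hf 0).2).1 (hμ _ (hf 1).1 (hf 1).2).1
      hadd.2.2 hsub.2.2

/-! ### The `n ≤ 2` core of the registered stub -/

/-- **`n ≤ 2` core of stub `stub_stationaryShellTiltRigidity`** (S2a₅, crux `BallSpecifiedInversionUpgrade`,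
stmt-CriticalPhenomena-11248, line `birth` r5; registered sub-goal `stationaryShellTilt_moment_le_two`): under the
crux antecedent `H`, a normalised shell-tilt family `ν_s := g s · μ` in the exact low-order class of `μ` has the
punctured moments of `μ` of orders `0`, `1`, `2` (probability / centredness / polarisation of the exact second
moments; `μ`'s side by `stub_lowOrderClass` (a), (b) and `IsGibbsFor γ μ univ`).  The statement is the registered
stub's with the extra hypothesis `n ≤ 2` (written with the namespaces `MeasureTheory`,
`Literature.Probability.LatticeModels`, `Literature.MathematicalPhysics.QuantumLattice` open, so that the registered
one-line signature stays under the stub registry's 4000-character cap; alpha-equivalent to the fully qualified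
form); the consistency, (DI), (RI) and exterior-measurability hypotheses are carried but not used. [cite: GlimmJaffe1987, §6.1] -/
theorem stationaryShellTilt_moment_le_two :
    ∀ (ρ : ℝ → ℝ) (Δ : ℝ) (S : CorrFamily 3) (L : ℝ → ℕ) (μ : Measure (FieldConfig (EuclideanSpace ℝ (Fin 3)))) (γ : EuclideanSpace ℝ (Fin 3) → ℝ → FieldConfig (EuclideanSpace ℝ (Fin 3)) → Measure (FieldConfig (EuclideanSpace ℝ (Fin 3)))), ((∀ δ ∈ Set.Ioc (0:ℝ) 1, 0 < ρ δ) ∧ 0 < Δ ∧ HasPointwiseScalingLimit (criticalCorr 3) ρ S ∧ (∀ n z, z ∉ NonCoincident 3 n → S n z = 0) ∧ IsNondegenerateTwoPoint S ∧ IsEuclideanInvariant S ∧ IsScaleCovariant Δ S ∧ Filter.Tendsto (fun δ : ℝ => δ * L δ) (nhdsWithin 0 (Set.Ioi 0)) Filter.atTop ∧ TendstoInLaw (fun δ => spinFieldLaw (isingMeasure (zdGraph 3) (box 3 (L δ)) (criticalBeta 3) 0 BoundaryCondition.plus) (box 3 (L δ)) δ (ρ δ)) (nhdsWithin 0 (Set.Ioi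 0)) μ ∧ HasMomentDensity μ S ∧ IsEuclideanInvariantLaw μ ∧ (∀ (s : ℝ) (hs : 0 < s), Measure.map (FieldConfig.act ((s ^ (Δ - 3)) • dilateTest s hs.ne')) μ = μ) ∧ (∀ c r, 0 < r → ∀ η, IsProbabilityMeasure (γ c r η)) ∧ (∀ c r, 0 < r → ∀ A, MeasurableSet A → Measurable[extEvents (Metric.closedBall c r)ᶜ] (fun η => γ c r η A)) ∧ (∀ c r, 0 < r → ∀ A, MeasurableSet[extEvents (Metric.ball c r)] A → Measurable[germEvents c r] (fun η => γ c r η A)) ∧ (∀ c r, 0 < r → ∀ η, ∀ᵐ ω ∂(γ c r η), ∀ f : SchwartzMap (EuclideanSpace ℝ (Fin 3)) ℝ, tsupport (f : EuclideanSpace ℝ (Fin 3) → ℝ) ⊆ (Metric.closedBall c r)ᶜ → ω f = η f) ∧ IsGibbsFor γ μ Set.univ) → ∀ g : ℝ → FieldConfig (EuclideanSpace ℝ (Fin 3)) → ENNReal, (∀ s : ℝ, 0 < s → s < 1 → Measurable (g s) ∧ Measurable[extEvents ({x : EuclideanSpace ℝ (Fin 3) | s < ‖x‖ ∧ ‖x‖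 < s⁻¹})ᶜ] (g s) ∧ ∫⁻ ω, g s ω ∂μ = 1) → (∀ s s' : ℝ, 0 < s → s ≤ s' → s' < 1 → ∀ A, MeasurableSet[extEvents {x : EuclideanSpace ℝ (Fin 3) | s' < ‖x‖ ∧ ‖x‖ < s'⁻¹}] A → ((fun s : ℝ => μ.withDensity (g s)) s) A = ((fun s : ℝ => μ.withDensity (g s)) s') A) → (∀ (l : ℝ) (hl : 0 < l) (s s' : ℝ), 0 < s → s ≤ l * s' → l * s ≤ s' → s' < 1 → ∀ A, MeasurableSet[extEvents {x : EuclideanSpace ℝ (Fin 3) | s' < ‖x‖ ∧ ‖x‖ < s'⁻¹}] A → ((fun s : ℝ => μ.withDensity (g s)) s) ((FieldConfig.act ((l ^ (Δ - 3)) • dilateTest l hl.ne')) ⁻¹' A) = ((fun s : ℝ => μ.withDensity (g s)) s') A) → (∀ (R : EuclideanSpace ℝ (Fin 3) ≃ₗᵢ[ℝ] EuclideanSpace ℝ (Fin 3)) (s : ℝ), 0 < s → s < 1 → ∀ A, MeasurableSet[extEvents {x : EuclideanSpace ℝ (Fin 3) | s < ‖x‖ ∧ ‖x‖ < s⁻¹}]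 A → ((fun s : ℝ => μ.withDensity (g s)) s) ((rotateField R) ⁻¹' A) = ((fun s : ℝ => μ.withDensity (g s)) s) A) → (∀ s : ℝ, 0 < s → s < 1 → ∀ f : SchwartzMap (EuclideanSpace ℝ (Fin 3)) ℝ, HasCompactSupport (f : EuclideanSpace ℝ (Fin 3) → ℝ) → tsupport (f : EuclideanSpace ℝ (Fin 3) → ℝ) ⊆ {x : EuclideanSpace ℝ (Fin 3) | s < ‖x‖ ∧ ‖x‖ < s⁻¹} → MemLp (fun ω : FieldConfig (EuclideanSpace ℝ (Fin 3)) => ω f) 2 ((fun s : ℝ => μ.withDensity (g s)) s) ∧ ∫ ω, ω f ∂((fun s : ℝ => μ.withDensity (g s)) s) = 0 ∧ ∫ ω, (ω f) ^ 2 ∂((fun s : ℝ => μ.withDensity (g s)) s) = ∫ ω, (ω f) ^ 2 ∂μ) → ∀ s : ℝ, 0 < s → s < 1 → ∀ (n : ℕ) (f : Fin n → SchwartzMap (EuclideanSpace ℝ (Fin 3)) ℝ), n ≤ 2 → (∀ i, (HasCompactSupport (f i : EuclideanSpace ℝ (Fin 3) → ℝ) ∧ tsupport (f i : EuclideanSpace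 ℝ (Fin 3) → ℝ) ⊆ {x : EuclideanSpace ℝ (Fin 3) | s < ‖x‖ ∧ ‖x‖ < s⁻¹})) → moment ((fun s : ℝ => μ.withDensity (g s)) s) n f = moment μ n f := by
  intro ρ Δ S L μ γ hH g hg _hcons _hDI _hRI hcls s hs hs1 n f hn hf
  obtain ⟨hL2μ, hmeanμ, -⟩ := stub_lowOrderClass ρ Δ S L μ γ hH
  obtain ⟨-, -, -, -, -, -, -, -, -, -, -, -, -, -, -, -, hGibbs⟩ := hH
  haveI : IsProbabilityMeasure μ := hGibbs.1
  haveI : IsProbabilityMeasure (μ.withDensity (g s)) :=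
    isProbabilityMeasure_withDensity_of_lintegral_eq_one (hg s hs hs1).2.2
  dsimp only at hcls ⊢
  exact moment_eq_of_exactClass_of_le_two (fun φ hφ _ => ⟨hL2μ φ hφ, hmeanμ φ⟩) (hcls s hs hs1) hn f hf

end Summit.CriticalPhenomena.Ising3DConformalLimit.BallSpecificationBallSpecifiedInversionUpgrade

end
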